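/-
Copyright (c) 2026 the pub-hodgecm-mathlib formalisation cell (harness21).  Prover seat hodgecm-mathlib-K2Liu-p06 (g3): Track B «K2-LIT»,
hLiu418 = stmt-HodgeConjecture-24832, director req649 (S1) ∕ LEAD F0P6-plan (g11) deal of record 2026-09-04T05:23:13Z = organ Φ2 of ROAD Φ
(ruling «M-155l» §2; CENSUS-41 row Φ2): file 1 «TWISTED THREE CELLS»; 2026-09-04.
-/
import Summits.HodgeConjecture.HodgeConjecture.Theorems.K2LiuConstantTermDelta            -- ★ O41.4 + ★ (b) `K2LiuConstantTermBigCellUnfold`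
import Summits.HodgeConjecture.HodgeConjecture.Theorems.K2LiuSiegelFourierCoeffDelta      -- ★ Φ1 (A2) vanishing, (A1) injectivity, (D) `whittakerDelta`
import HarnessLib

/-!
# Crux `HLiu418`, ROAD Φ, organ Φ2 (file 1): THE `ψ_S`-TWISTED THREE CELLS — the `S`-th Fourier coefficient of the Siegel Eisenstein series along `N_Δ`
# `∫ β • (conj ψ_S · E(·h; f)) dνN = (∫ β • conj ψ_S) f(h) + W_S(f)(h) + MID_S(f)(h)`, and the identity cell DIES for `ψ_S ≢ 1`

Cell `hodgecm-mathlib`, crux item hLiu418 = `stmt-HodgeConjecture-24832`, route `HCCMUnconditional`; squad K2 ∕ K2Liu, LEAD F0P6-plan (g11 → g12), deal req649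
(S1) (memo `F0/P6/F0P6-plan-g11/DEALS-req649-S1S2S3.v1.F0P6-plan-g11.md` §(S1): «Φ2 … the `ψ_β`-twisted three cells ⇒ for `det β ≠ 0` only the big cell»),
prover K2Liu-p06 (g3).  THEOREMS ONLY (no `def`, no instance, no notation, no named-fact hypothesis, no `sorry`); lane
`--supports stmt-HodgeConjecture-24832 --as helper` (count-neutral).

SETTING = ★ O41.4 `K2LiuConstantTermDelta.constTerm_three_cells` VERBATIM, plus an index `S ∈ M_n(L)`: `0 < n`; `νN` left-invariant on `N_Δ(𝔸)`; `β` an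
`N_Δ(L⁺)`-covering weight; `f` a continuous Siegel section of `I_Δ(s, χ)`; `E = eisensteinSeriesDelta f`; `w_Δ` presented rationally by `wq ν = w_Δ ν`;
the analytic binder (H) `∫⁻ (Σ'_q ‖f(γ_q u h)‖ₑ) β(u) dνN ≠ ∞`; `REST = P_Δ(L⁺)\H(L⁺) ∖ ({[1]} ∪ [w_Δ N_Δ(L⁺)])`.  The twist `conj ψ_S(u)`
(★ Φ1 (D) `unipDeltaChar`) is unimodular, so every majorant and every finiteness statement of ★ (b) `three_cells_ne_top` carries over unchanged.

* **`fourierCoeff_three_cells`** (T1): `∫ β(u) • (conj ψ_S(u) · E(u h)) dνN(u) = (∫ β • conj ψ_S dνN) · f(h) + whittakerDelta νN S f h + MID_S(h)`,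
  `MID_S(h) = ∫ β(u) • (conj ψ_S(u) · Σ'_{q ∈ REST} f(γ_q u h)) dνN(u)` — identity cell, the `S`-TWISTED BIG CELL `W_S(f)(h) = ∫_{N_Δ(𝔸)} conj ψ_S(u)
  f(w_Δ u h) dνN` (★ Φ1 (D); the FULL twisted intertwining integral, because the big cell is one free `N_Δ(L⁺)`-orbit, ★ (a) `K2LiuSiegelBigCellFree`),
  and the middle cosets carried verbatim.
* **`fourierCoeff_cells_of_ne_one`** (T2): if `ψ_S(u₀) ≠ 1` for some `u₀ ∈ N_Δ(𝔸)` the identity cell VANISHES (★ Φ1 (A2)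
  `integral_wt_smul_unipDeltaChar_eq_zero`): `∫ β • (conj ψ_S · E(·h)) = W_S(f)(h) + MID_S(h)`; `exists_unipDeltaChar_ne_one_of_ne_zero` (T2′):
  every non-zero `T_L`-skew rational `S` has such a `u₀` (★ Φ1 (A1) INJECTIVITY).
* **`fourierCoeffDelta_eisensteinSeriesDelta_of_ne_one`** (T3): the normalised coefficient of ★ Φ1: `E_S(h) := fourierCoeffDelta νN β S E h =
  (∫ β dνN)⁻¹ • (W_S(f)(h) + MID_S(h))`.
What is NOT here: «`det S ≠ 0 ⇒ MID_S = 0`».  Each middle `N_Δ(L⁺)`-orbit vanishes by the ORBIT-VANISHING CRITERION of the sequel file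
`K2LiuSiegelEisensteinCoeffOrbitVanishing` (translation by a stabiliser element `s₀ ∈ N_Δ(𝔸)` with `ψ_S(s₀) ≠ 1`); summing the criterion over
REST needs the Bruhat EXHAUSTION «REST = ⋃ middle `w_g`-cells» (organ O41.1 part B2c, not yet in the tree).
[MoeglinWaldspurger1995, II.1.7], [KudlaRallis1994, §2], [Tan1999, §3], [Shimura1997, §18.3], [GelbartPiatetskishapiroRallis1987, Part A §2], [Garrett2018, §3.10].

HONEST LABEL.  Count-neutral helper; `HC_CM` is proved only modulo the 7 printed citations (2 remaining named inputs: hLiu418 = `stmt-HodgeConjecture-24832`,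
h413 = `stmt-HodgeConjecture-24833`) until rung 0 closes.
-/

set_option autoImplicit false
set_option linter.dupNamespace false -- the mandated namespace repeats `HodgeConjecture.HodgeConjecture`

noncomputable section

open scoped Matrix ENNReal NNReal ComplexConjugate
open NumberField IsDedekindDomain MeasureTheory MeasureTheory.Measure Filter Set Function
open Literature.NumberTheory.Automorphic Literature.NumberTheory.GaloisRepresentations
open Literature.NumberTheory.GelbartRogawski1991 Literature.NumberTheory.GelbartRogawski1991.GRConstruction
open Literature.NumberTheory.K2Lit.SiegelDoubled Literature.MeasureTheory.Group

namespace Summit.HodgeConjecture.HodgeConjecture.Cruxes.HLiu418.K2LiuSiegelEisensteinCoeffCells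

open K2LiuSiegelBigCellFree K2LiuSiegelEisensteinDoubledLeftInvariant K2LiuSiegelDoubledUnfold K2LiuUnipotentCoveringWeight
  K2LiuConstantTermBigCellUnfold K2LiuConstantTermDelta K2LiuSiegelUnipotentFourierDefs K2LiuSiegelUnipotentCharacters K2LiuSiegelFourierCoeffDelta

variable {L : Type} [Field L] [NumberField L] [IsCMField L]
variable {N M n : ℕ} {e : Fin N × Fin M ≃ Fin n}
  {dV : Fin N → L} {hdV : ∀ i, IsCMField.complexConj L (dV i) = dV i}
  {dW : Fin M → L} {hdW : ∀ i, IsCMField.complexConj L (dW i) = dW i}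
variable [MeasurableSpace (unipDelta L e dV hdV dW hdW)] [BorelSpace (unipDelta L e dV hdV dW hdW)]

/-! ## §1 The twisted summand -/

/-- the twisted weighted summand `u ↦ β(u) • (conj ψ_S(u) · f(a (u h)))` is a.e.-strongly measurable. [folklore] -/
theorem aestronglyMeasurable_wt_smul_conj_mul_apply (νN : Measure (unipDelta L e dV hdV dW hdW)) {β : unipDelta L e dV hdV dW hdW → ℝ≥0∞}
    (hβm : Measurable β) (S : Matrix (Fin n) (Fin n) L) {f : HA L e dV hdV dW hdW → ℂ} (hfc : Continuous f) (a h : HA L e dV hdV dW hdW) :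
    AEStronglyMeasurable (fun u : unipDelta L e dV hdV dW hdW =>
      (β u).toReal • (conj (unipDeltaChar L e dV hdV dW hdW S (u : HA L e dV hdV dW hdW) : ℂ) * f (a * ((u : HA L e dV hdV dW hdW) * h)))) νN :=
  (hβm.ennreal_toReal.smul (((Complex.continuous_conj.comp (continuous_unipDeltaChar_coe L e dV hdV dW hdW S)).mul
    (hfc.comp (continuous_const.mul (continuous_subtype_val.mul continuous_const)))).measurable)).aestronglyMeasurable

omit [BorelSpace (unipDelta L e dV hdV dW hdW)] in
/-- `‖β(u) • (conj ψ_S(u) · z)‖ₑ = ‖z‖ₑ · β(u)` — the twist is unimodular, so O41.4's majorants are unchanged. [cite: Tan1999, §3] -/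
theorem enorm_wt_smul_conj_mul {β : unipDelta L e dV hdV dW hdW → ℝ≥0∞} (hβ : IsCoveringWeight (unipDeltaRat L e dV hdV dW hdW) β)
    (S : Matrix (Fin n) (Fin n) L) (u : unipDelta L e dV hdV dW hdW) (z : ℂ) :
    ‖(β u).toReal • (conj (unipDeltaChar L e dV hdV dW hdW S (u : HA L e dV hdV dW hdW) : ℂ) * z)‖ₑ = ‖z‖ₑ * β u := by
  rw [enorm_wt_smul hβ u, ← ofReal_norm, norm_conj_unipDeltaChar_mul, ofReal_norm]

/-! ## §2 The twisted unfolding of the free `w_Δ`-orbit -/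

/-- **`∫ β(u) • (conj ψ_S(u) · Σ'_ν f(w_Δ ν u h)) dνN = W_S(f)(h)`** as soon as `u ↦ f(w_Δ u h)` is `νN`-integrable in norm: the Bochner unfolding of the
free orbit (★ `integral_wt_smul_eq_integral_wt_smul_tsum`, `Γ' = 1`) for the left-`N_Δ(L⁺)`-INVARIANT integrand `conj ψ_S(u) f(w_Δ u h)` (`ψ_S(ν u) = ψ_S(u)`,
★ Φ1 (A1) `unipDeltaChar_rat_mul`). [cite: Garrett2018, §3.10] [cite: KudlaRallis1994, §2] [cite: Tan1999, §3] -/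
theorem integral_wt_smul_conj_mul_tsum_weylDelta_orbit (νN : Measure (unipDelta L e dV hdV dW hdW)) [νN.IsMulLeftInvariant]
    {β : unipDelta L e dV hdV dW hdW → ℝ≥0∞} (hβ : IsCoveringWeight (unipDeltaRat L e dV hdV dW hdW) β) (S : Matrix (Fin n) (Fin n) L)
    {f : HA L e dV hdV dW hdW → ℂ} (hfc : Continuous f) (h : HA L e dV hdV dW hdW)
    (hint : ∫⁻ u, ‖f (weylDelta L e dV hdV dW hdW * (u : HA L e dV hdV dW hdW) * h)‖ₑ ∂νN ≠ ∞) :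
    ∫ u, (β u).toReal • (conj (unipDeltaChar L e dV hdV dW hdW S (u : HA L e dV hdV dW hdW) : ℂ) * (∑' ν : unipDeltaRat L e dV hdV dW hdW,
        f (weylDelta L e dV hdV dW hdW * ((ν : unipDelta L e dV hdV dW hdW) : HA L e dV hdV dW hdW) * ((u : HA L e dV hdV dW hdW) * h)))) ∂νN =
      whittakerDelta L e dV hdV dW hdW νN S f h := by
  haveI : Countable (unipDeltaRat L e dV hdV dW hdW) := countable_unipDeltaRat L e dV hdV dW hdW
  haveI : MeasurableConstSMul (unipDelta L e dV hdV dW hdW) (unipDelta L e dV hdV dW hdW) := ⟨fun g => measurable_const_mul g⟩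
  haveI : SMulInvariantMeasure (unipDelta L e dV hdV dW hdW) (unipDelta L e dV hdV dW hdW) νN :=
    ⟨fun g s _hs => by rw [show (fun x : unipDelta L e dV hdV dW hdW => g • x) ⁻¹' s = (fun x => g * x) ⁻¹' s from rfl, measure_preimage_mul]⟩
  set F : unipDelta L e dV hdV dW hdW → ℂ := fun u =>
    conj (unipDeltaChar L e dV hdV dW hdW S (u : HA L e dV hdV dW hdW) : ℂ) * f (weylDelta L e dV hdV dW hdW * (u : HA L e dV hdV dW hdW) * h) with hF
  have hFm : StronglyMeasurable F := ((Complex.continuous_conj.comp (continuous_unipDeltaChar_coe L e dV hdV dW hdW S)).mul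
    (hfc.comp ((continuous_const.mul continuous_subtype_val).mul continuous_const))).stronglyMeasurable
  have h1w : ∀ x : unipDelta L e dV hdV dW hdW, coveringSum (⊥ : Subgroup (unipDelta L e dV hdV dW hdW)) (fun _ => (1 : ℝ≥0∞)) x = 1 := by
    intro x
    rw [coveringSum_apply, tsum_eq_single (1 : (⊥ : Subgroup (unipDelta L e dV hdV dW hdW))) (fun b hb => absurd (Subsingleton.elim b 1) hb)]
  have hs : ∀ γ ∈ unipDeltaRat L e dV hdV dW hdW, ∃! i : unipDeltaRat L e dV hdV dW hdW,
      γ * ((i : unipDelta L e dV hdV dW hdW))⁻¹ ∈ (⊥ : Subgroup (unipDelta L e dV hdV dW hdW)) := by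
    intro γ hγ
    refine ⟨⟨γ, hγ⟩, by simp, fun i hi => ?_⟩
    have hi' : γ * ((i : unipDelta L e dV hdV dW hdW))⁻¹ ∈ (⊥ : Subgroup (unipDelta L e dV hdV dW hdW)) := hi
    rw [Subgroup.mem_bot, mul_inv_eq_one] at hi'
    exact Subtype.ext hi'.symm
  have hFint : ∫⁻ u, ‖F u‖ₑ * (1 : ℝ≥0∞) ∂νN < ∞ := by
    simp only [mul_one, hF, ← ofReal_norm, norm_conj_unipDeltaChar_mul]
    simp only [ofReal_norm]
    exact lt_top_iff_ne_top.2 hint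
  have key := integral_wt_smul_eq_integral_wt_smul_tsum νN (unipDeltaRat L e dV hdV dW hdW) ⊥ bot_le (F := F) hFm
    (fun γ hγ x => by rw [Subgroup.mem_bot] at hγ; rw [hγ, one_smul]) (β' := fun _ => 1) (β := β) measurable_const h1w hβ.1 hβ.2
    (s := fun i : unipDeltaRat L e dV hdV dW hdW => (i : unipDelta L e dV hdV dW hdW)) (fun i => i.2) hs hFint
  have hwt1 : ∀ x : unipDelta L e dV hdV dW hdW, wt (fun _ => (1 : ℝ≥0∞)) x • F x = F x := fun x => by simp [wt]
  simp_rw [hwt1] at key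
  have hψν : ∀ (ν : unipDeltaRat L e dV hdV dW hdW) (u : unipDelta L e dV hdV dW hdW),
      unipDeltaChar L e dV hdV dW hdW S (((ν : unipDelta L e dV hdV dW hdW) : HA L e dV hdV dW hdW) * (u : HA L e dV hdV dW hdW)) =
        unipDeltaChar L e dV hdV dW hdW S (u : HA L e dV hdV dW hdW) := fun ν u => by
    rw [← Subgroup.coe_mul]; exact unipDeltaChar_rat_mul L e dV hdV dW hdW S ν u
  rw [whittakerDelta_def, show (∫ u, conj (unipDeltaChar L e dV hdV dW hdW S (u : HA L e dV hdV dW hdW) : ℂ) *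
      f (weylDelta L e dV hdV dW hdW * (u : HA L e dV hdV dW hdW) * h) ∂νN) = ∫ u, F u ∂νN from rfl, key]
  refine integral_congr_ae (ae_of_all _ fun u => ?_)
  show (β u).toReal • _ = wt β u • _
  rw [← tsum_mul_left]
  congr 1
  refine tsum_congr fun ν => ?_
  rw [hF]
  simp only [smul_eq_mul, Subgroup.coe_mul, hψν, mul_assoc]

/-! ## §3 THE TWISTED THREE CELLS -/

section Main

variable (wq : unipDeltaRat L e dV hdV dW hdW → ratH L e dV hdV dW hdW)
  (hwq : ∀ ν, ((wq ν : ratH L e dV hdV dW hdW) : HA L e dV hdV dW hdW) =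
    weylDelta L e dV hdV dW hdW * ((ν : unipDelta L e dV hdV dW hdW) : HA L e dV hdV dW hdW))

set_option maxHeartbeats 400000 in
include hwq in
/-- **Φ2 (T1, «ORBIT FORM») — THE `S`-th FOURIER COEFFICIENT OF THE SIEGEL EISENSTEIN SERIES ALONG `N_Δ` SPLITS INTO THREE CELLS:**
  `∫ β(u) • (conj ψ_S(u) · E(u h; f)) dνN(u) = (∫ β • conj ψ_S dνN) · f(h) + whittakerDelta νN S f h + ∫ β(u) • (conj ψ_S(u) · Σ'_{q ∈ REST} f(γ_q u h)) dνN(u)`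
(setting and binder (H) of ★ O41.4; `S = 0` IS ★ O41.4 by ★ (D) `whittakerDelta_zero_index`).  Identity cell, TWISTED BIG CELL `W_S(f)(h)` (the full
twisted intertwining integral — the big cell is free), middle cosets verbatim.  All three are absolutely convergent Bochner integrals under (H)
(★ (b) `three_cells_ne_top`; the twist is unimodular). [cite: MoeglinWaldspurger1995, II.1.7] [cite: KudlaRallis1994, §2] [cite: Tan1999, §3]
[cite: Shimura1997, §18.3] [cite: Garrett2018, §3.10] -/
theorem fourierCoeff_three_cells (hn : 0 < n) (νN : Measure (unipDelta L e dV hdV dW hdW)) [νN.IsMulLeftInvariant]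
    {β : unipDelta L e dV hdV dW hdW → ℝ≥0∞} (hβ : IsCoveringWeight (unipDeltaRat L e dV hdV dW hdW) β)
    {χ : HeckeCharacter L} {s : ℂ} {f : HA L e dV hdV dW hdW → ℂ} (hf : IsSiegelDeltaSection L e dV hdV dW hdW χ s f) (hfc : Continuous f)
    (h : HA L e dV hdV dW hdW)
    (hH : ∫⁻ u, (∑' q : SiegelDeltaQuot L e dV hdV dW hdW,
        ‖f ((((Quotient.out q : ratH L e dV hdV dW hdW) : HA L e dV hdV dW hdW)) * ((u : HA L e dV hdV dW hdW) * h))‖ₑ) * β u ∂νN ≠ ∞)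
    (S : Matrix (Fin n) (Fin n) L) :
    ∫ u, (β u).toReal • (conj (unipDeltaChar L e dV hdV dW hdW S (u : HA L e dV hdV dW hdW) : ℂ) *
        eisensteinSeriesDelta L e dV hdV dW hdW f ((u : HA L e dV hdV dW hdW) * h)) ∂νN =
      (∫ u, (β u).toReal • conj (unipDeltaChar L e dV hdV dW hdW S (u : HA L e dV hdV dW hdW) : ℂ) ∂νN) * f h +
        whittakerDelta L e dV hdV dW hdW νN S f h +
        ∫ u, (β u).toReal • (conj (unipDeltaChar L e dV hdV dW hdW S (u : HA L e dV hdV dW hdW) : ℂ) *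
          (∑' q : ↥(({Quotient.mk (MulAction.orbitRel (siegelDeltaRat L e dV hdV dW hdW) (ratH L e dV hdV dW hdW)) 1} ∪
            Set.range (fun ν : unipDeltaRat L e dV hdV dW hdW =>
              (Quotient.mk (MulAction.orbitRel (siegelDeltaRat L e dV hdV dW hdW) (ratH L e dV hdV dW hdW)) (wq ν) :
                SiegelDeltaQuot L e dV hdV dW hdW)))ᶜ : Set (SiegelDeltaQuot L e dV hdV dW hdW)),
          f ((((Quotient.out (q : SiegelDeltaQuot L e dV hdV dW hdW) : ratH L e dV hdV dW hdW) : HA L e dV hdV dW hdW)) *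
            ((u : HA L e dV hdV dW hdW) * h)))) ∂νN := by
  haveI : Countable (unipDeltaRat L e dV hdV dW hdW) := countable_unipDeltaRat L e dV hdV dW hdW
  haveI : Countable (ratH L e dV hdV dW hdW) := countable_ratH L e dV hdV dW hdW
  haveI : Countable (SiegelDeltaQuot L e dV hdV dW hdW) := by unfold SiegelDeltaQuot; exact inferInstance
  -- notation (as in ★ O41.4)
  set q₁ : SiegelDeltaQuot L e dV hdV dW hdW :=
    Quotient.mk (MulAction.orbitRel (siegelDeltaRat L e dV hdV dW hdW) (ratH L e dV hdV dW hdW)) 1 with hq₁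
  set qw : unipDeltaRat L e dV hdV dW hdW → SiegelDeltaQuot L e dV hdV dW hdW := fun ν =>
    (Quotient.mk (MulAction.orbitRel (siegelDeltaRat L e dV hdV dW hdW) (ratH L e dV hdV dW hdW)) (wq ν) :
      SiegelDeltaQuot L e dV hdV dW hdW) with hqw
  set ψc : unipDelta L e dV hdV dW hdW → ℂ := fun u => conj (unipDeltaChar L e dV hdV dW hdW S (u : HA L e dV hdV dW hdW) : ℂ) with hψc
  set Fq : SiegelDeltaQuot L e dV hdV dW hdW → unipDelta L e dV hdV dW hdW → ℂ := fun q u =>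
    f ((((Quotient.out q : ratH L e dV hdV dW hdW) : HA L e dV hdV dW hdW)) * ((u : HA L e dV hdV dW hdW) * h)) with hFq
  set g : SiegelDeltaQuot L e dV hdV dW hdW → unipDelta L e dV hdV dW hdW → ℂ := fun q u => (β u).toReal • (ψc u * Fq q u) with hg
  have hgm : ∀ q, AEStronglyMeasurable (g q) νN := fun q => aestronglyMeasurable_wt_smul_conj_mul_apply νN hβ.1 S hfc _ h
  have hFqm : ∀ q, Measurable fun u => ‖Fq q u‖ₑ := fun q => measurable_enorm_apply_mul_coe_mul' hfc _ h
  have hgn : ∀ q u, ‖g q u‖ₑ = ‖Fq q u‖ₑ * β u := fun q u => enorm_wt_smul_conj_mul hβ S u _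
  -- the three finiteness statements of ★ (b)
  obtain ⟨-, hfin2, -⟩ := three_cells_ne_top wq hwq hn νN hβ hf hfc h hH
  -- Step 1: Fubini for series under (H): `∫ β • (ψc · E(·h)) = Σ'_q ∫ g q`
  have hsum : ∑' q, ∫⁻ u, ‖g q u‖ₑ ∂νN ≠ ∞ := by
    simp_rw [hgn]
    rw [← lintegral_tsum (f := fun q u => ‖Fq q u‖ₑ * β u) fun q => ((hFqm q).mul hβ.1).aemeasurable]
    simp_rw [ENNReal.tsum_mul_right]
    exact hH
  have h1 : ∫ u, (β u).toReal • (ψc u * eisensteinSeriesDelta L e dV hdV dW hdW f ((u : HA L e dV hdV dW hdW) * h)) ∂νN = ∑' q, ∫ u, g q u ∂νN := by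
    rw [← integral_tsum hgm hsum]
    refine integral_congr_ae (ae_of_all _ fun u => ?_)
    show (β u).toReal • (ψc u * eisensteinSeriesDelta L e dV hdV dW hdW f ((u : HA L e dV hdV dW hdW) * h)) = ∑' q, (β u).toReal • (ψc u * Fq q u)
    rw [tsum_const_smul'' (β u).toReal, tsum_mul_left]
    rfl
  -- Step 2: the series `q ↦ J q = ∫ g q` is absolutely summable; split it along `{q₁} ⊔ range qw ⊔ REST`
  set J : SiegelDeltaQuot L e dV hdV dW hdW → ℂ := fun q => ∫ u, g q u ∂νN with hJ
  have hJs : Summable J := by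
    refine Summable.of_norm_bounded (ENNReal.summable_toReal hsum) fun q => ?_
    rw [← toReal_enorm (J q)]
    exact ENNReal.toReal_mono (ENNReal.ne_top_of_tsum_ne_top hsum q) (enorm_integral_le_lintegral_enorm _)
  have hdisj : Disjoint ({q₁} : Set (SiegelDeltaQuot L e dV hdV dW hdW)) (Set.range qw) := by
    rw [Set.disjoint_singleton_left]
    rintro ⟨ν, hν⟩
    exact mk_wq_ne_mk_one wq hwq hn ν hν
  have hB : ∑' q, J q = J q₁ + ∑' ν, J (qw ν) + ∑' q : ↥(({q₁} ∪ Set.range qw)ᶜ : Set (SiegelDeltaQuot L e dV hdV dW hdW)), J q := by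
    rw [← (hJs.subtype _).tsum_add_tsum_compl (hJs.subtype (({q₁} ∪ Set.range qw)ᶜ : Set (SiegelDeltaQuot L e dV hdV dW hdW))),
      (hJs.subtype _).tsum_union_disjoint hdisj (hJs.subtype _), tsum_singleton, tsum_range J (mk_wq_injective wq hwq)]
  -- Step 3a: the identity cell
  have hC : J q₁ = (∫ u, (β u).toReal • ψc u ∂νN) * f h := by
    have h1' : ∀ u : unipDelta L e dV hdV dW hdW, g q₁ u = ((β u).toReal • ψc u) * f h := fun u => by
      rw [hg, hFq]
      dsimp only
      rw [hq₁, apply_out_mk_one_mul hf, apply_unipDelta_mul hf u.2 h, smul_mul_assoc]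
    show (∫ u, g q₁ u ∂νN) = _
    simp_rw [h1']
    exact integral_mul_const (f h) _
  -- Step 3b: the free `w_Δ`-cell re-sums to the TWISTED intertwining integral `W_S(f)(h)`
  have hD : ∑' ν, J (qw ν) = whittakerDelta L e dV hdV dW hdW νN S f h := by
    have hsum2 : ∑' ν, ∫⁻ u, ‖g (qw ν) u‖ₑ ∂νN ≠ ∞ := by
      simp_rw [hgn]
      rw [← lintegral_tsum (f := fun ν u => ‖Fq (qw ν) u‖ₑ * β u) fun ν => ((hFqm (qw ν)).mul hβ.1).aemeasurable]
      simp_rw [ENNReal.tsum_mul_right]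
      have h2 : ∀ (u : unipDelta L e dV hdV dW hdW) (ν : unipDeltaRat L e dV hdV dW hdW), ‖Fq (qw ν) u‖ₑ =
          ‖f (weylDelta L e dV hdV dW hdW * ((ν : unipDelta L e dV hdV dW hdW) : HA L e dV hdV dW hdW) * ((u : HA L e dV hdV dW hdW) * h))‖ₑ := by
        intro u ν
        rw [hFq]
        dsimp only
        rw [hqw]
        dsimp only
        rw [apply_out_mk_wq_mul wq hwq hf ν]
      simp_rw [h2]
      rw [lintegral_weylDelta_orbit_unfold νN hβ hfc h]
      exact hfin2
    rw [show (∑' ν, J (qw ν)) = ∑' ν, ∫ u, g (qw ν) u ∂νN from rfl, ← integral_tsum (fun ν => hgm (qw ν)) hsum2,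
      ← integral_wt_smul_conj_mul_tsum_weylDelta_orbit νN hβ S hfc h hfin2]
    refine integral_congr_ae (ae_of_all _ fun u => ?_)
    show (∑' ν, (β u).toReal • (ψc u * Fq (qw ν) u)) = _
    rw [tsum_const_smul'' (β u).toReal, tsum_mul_left]
    congr 2
    refine tsum_congr fun ν => ?_
    rw [hFq]
    dsimp only
    rw [hqw]
    dsimp only
    rw [apply_out_mk_wq_mul wq hwq hf ν]
  -- Step 3c: the remaining cosets, Fubini backwards
  have hE : ∑' q : ↥(({q₁} ∪ Set.range qw)ᶜ : Set (SiegelDeltaQuot L e dV hdV dW hdW)), J q =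
      ∫ u, (β u).toReal • (ψc u * (∑' q : ↥(({q₁} ∪ Set.range qw)ᶜ : Set (SiegelDeltaQuot L e dV hdV dW hdW)), Fq q u)) ∂νN := by
    have hsum3 : ∑' q : ↥(({q₁} ∪ Set.range qw)ᶜ : Set (SiegelDeltaQuot L e dV hdV dW hdW)), ∫⁻ u, ‖g q u‖ₑ ∂νN ≠ ∞ :=
      ne_top_of_le_ne_top hsum (ENNReal.tsum_comp_le_tsum_of_injective Subtype.val_injective _)
    rw [show (∑' q : ↥(({q₁} ∪ Set.range qw)ᶜ : Set (SiegelDeltaQuot L e dV hdV dW hdW)), J q) =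
        ∑' q : ↥(({q₁} ∪ Set.range qw)ᶜ : Set (SiegelDeltaQuot L e dV hdV dW hdW)), ∫ u, g q u ∂νN from rfl,
      ← integral_tsum (f := fun (q : ↥(({q₁} ∪ Set.range qw)ᶜ : Set (SiegelDeltaQuot L e dV hdV dW hdW))) u => g q u)
        (fun q => hgm q) hsum3]
    refine integral_congr_ae (ae_of_all _ fun u => ?_)
    show (∑' q : ↥(({q₁} ∪ Set.range qw)ᶜ : Set (SiegelDeltaQuot L e dV hdV dW hdW)), (β u).toReal • (ψc u * Fq q u)) = _
    rw [tsum_const_smul'' (β u).toReal, tsum_mul_left]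
  rw [h1, hB, hC]
  exact congrArg₂ (fun x y => (∫ u, (β u).toReal • ψc u ∂νN) * f h + x + y) hD hE

include hwq in
/-- **Φ2 (T2) — THE IDENTITY CELL DIES FOR A NON-TRIVIAL TWIST**: if `ψ_S(u₀) ≠ 1` for some `u₀ ∈ N_Δ(𝔸)` (e.g. every non-zero `T_L`-skew rational `S`,
`exists_unipDeltaChar_ne_one_of_ne_zero`), then under (H)
  `∫ β(u) • (conj ψ_S(u) · E(u h; f)) dνN(u) = W_S(f)(h) + ∫ β(u) • (conj ψ_S(u) · Σ'_{q ∈ REST} f(γ_q u h)) dνN(u)`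
(★ Φ1 (A2) `integral_wt_smul_unipDeltaChar_eq_zero`: `∫ β • conj ψ_S = 0`).  [cite: KudlaRallis1994, §2] [cite: Tan1999, §3] [cite: MoeglinWaldspurger1995, II.1.7] -/
theorem fourierCoeff_cells_of_ne_one (hn : 0 < n) (νN : Measure (unipDelta L e dV hdV dW hdW)) [νN.IsMulLeftInvariant]
    {β : unipDelta L e dV hdV dW hdW → ℝ≥0∞} (hβ : IsCoveringWeight (unipDeltaRat L e dV hdV dW hdW) β)
    {χ : HeckeCharacter L} {s : ℂ} {f : HA L e dV hdV dW hdW → ℂ} (hf : IsSiegelDeltaSection L e dV hdV dW hdW χ s f) (hfc : Continuous f)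
    (h : HA L e dV hdV dW hdW)
    (hH : ∫⁻ u, (∑' q : SiegelDeltaQuot L e dV hdV dW hdW,
        ‖f ((((Quotient.out q : ratH L e dV hdV dW hdW) : HA L e dV hdV dW hdW)) * ((u : HA L e dV hdV dW hdW) * h))‖ₑ) * β u ∂νN ≠ ∞)
    (S : Matrix (Fin n) (Fin n) L) {u₀ : unipDelta L e dV hdV dW hdW} (hu₀ : unipDeltaChar L e dV hdV dW hdW S (u₀ : HA L e dV hdV dW hdW) ≠ 1) :
    ∫ u, (β u).toReal • (conj (unipDeltaChar L e dV hdV dW hdW S (u : HA L e dV hdV dW hdW) : ℂ) *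
        eisensteinSeriesDelta L e dV hdV dW hdW f ((u : HA L e dV hdV dW hdW) * h)) ∂νN =
      whittakerDelta L e dV hdV dW hdW νN S f h +
        ∫ u, (β u).toReal • (conj (unipDeltaChar L e dV hdV dW hdW S (u : HA L e dV hdV dW hdW) : ℂ) *
          (∑' q : ↥(({Quotient.mk (MulAction.orbitRel (siegelDeltaRat L e dV hdV dW hdW) (ratH L e dV hdV dW hdW)) 1} ∪
            Set.range (fun ν : unipDeltaRat L e dV hdV dW hdW =>
              (Quotient.mk (MulAction.orbitRel (siegelDeltaRat L e dV hdV dW hdW) (ratH L e dV hdV dW hdW)) (wq ν) :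
                SiegelDeltaQuot L e dV hdV dW hdW)))ᶜ : Set (SiegelDeltaQuot L e dV hdV dW hdW)),
          f ((((Quotient.out (q : SiegelDeltaQuot L e dV hdV dW hdW) : ratH L e dV hdV dW hdW) : HA L e dV hdV dW hdW)) *
            ((u : HA L e dV hdV dW hdW) * h)))) ∂νN := by
  have h0 : ∫ u, (β u).toReal • conj (unipDeltaChar L e dV hdV dW hdW S (u : HA L e dV hdV dW hdW) : ℂ) ∂νN = 0 := by
    have h1 := integral_wt_smul_unipDeltaChar_eq_zero L e dV hdV dW hdW νN hβ (-S) (u₀ := u₀)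
      (by rw [unipDeltaChar_neg, ne_eq, inv_eq_one]; exact hu₀)
    simpa only [coe_unipDeltaChar_neg] using h1
  have h3 := fourierCoeff_three_cells wq hwq hn νN hβ hf hfc h hH S
  rw [h0, zero_mul, zero_add] at h3
  exact h3

omit [MeasurableSpace (unipDelta L e dV hdV dW hdW)] [BorelSpace (unipDelta L e dV hdV dW hdW)] in
/-- **(T2′) every non-zero `T_L`-skew rational index has a non-trivial character on `N_Δ(𝔸)`** (contrapositive of ★ Φ1 (A1) INJECTIVITY
`eq_zero_of_forall_unipDeltaChar_eq_one`). [cite: Shimura1997, §18.1] [cite: Tan1999, §3] -/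
theorem exists_unipDeltaChar_ne_one_of_ne_zero (hdV0 : ∀ i, dV i ≠ 0) (hdW0 : ∀ i, dW i ≠ 0) {S : Matrix (Fin n) (Fin n) L}
    (hS : S ∈ skewMatrices ((IsCMField.complexConj L : L ≃ₐ[Fp L] L) : L →+* L) ((gramR L e dV hdV dW hdW).map (algebraMap (Fp L) L)))
    (hS0 : S ≠ 0) : ∃ u₀ : unipDelta L e dV hdV dW hdW, unipDeltaChar L e dV hdV dW hdW S (u₀ : HA L e dV hdV dW hdW) ≠ 1 := by
  by_contra hall
  push Not at hall
  exact hS0 (eq_zero_of_forall_unipDeltaChar_eq_one L e dV hdV dW hdW hdV0 hdW0 hS fun u hu => hall ⟨u, hu⟩)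

include hwq in
/-- **Φ2 (T3) — THE NORMALISED COEFFICIENT OF ★ Φ1**: `E_S(h) := fourierCoeffDelta νN β S (E f) h = (∫ β dνN)⁻¹ • (W_S(f)(h) + MID_S(h))` for a
non-trivial twist `ψ_S` (under (H)). [cite: KudlaRallis1994, §2] [cite: Tan1999, §3] [cite: Shimura1997, §18.3] -/
theorem fourierCoeffDelta_eisensteinSeriesDelta_of_ne_one (hn : 0 < n) (νN : Measure (unipDelta L e dV hdV dW hdW)) [νN.IsMulLeftInvariant]
    {β : unipDelta L e dV hdV dW hdW → ℝ≥0∞} (hβ : IsCoveringWeight (unipDeltaRat L e dV hdV dW hdW) β)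
    {χ : HeckeCharacter L} {s : ℂ} {f : HA L e dV hdV dW hdW → ℂ} (hf : IsSiegelDeltaSection L e dV hdV dW hdW χ s f) (hfc : Continuous f)
    (h : HA L e dV hdV dW hdW)
    (hH : ∫⁻ u, (∑' q : SiegelDeltaQuot L e dV hdV dW hdW,
        ‖f ((((Quotient.out q : ratH L e dV hdV dW hdW) : HA L e dV hdV dW hdW)) * ((u : HA L e dV hdV dW hdW) * h))‖ₑ) * β u ∂νN ≠ ∞)
    (S : Matrix (Fin n) (Fin n) L) {u₀ : unipDelta L e dV hdV dW hdW} (hu₀ : unipDeltaChar L e dV hdV dW hdW S (u₀ : HA L e dV hdV dW hdW) ≠ 1) :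
    fourierCoeffDelta L e dV hdV dW hdW νN β S (eisensteinSeriesDelta L e dV hdV dW hdW f) h =
      ((∫⁻ u, β u ∂νN).toReal⁻¹ : ℝ) • (whittakerDelta L e dV hdV dW hdW νN S f h +
        ∫ u, (β u).toReal • (conj (unipDeltaChar L e dV hdV dW hdW S (u : HA L e dV hdV dW hdW) : ℂ) *
          (∑' q : ↥(({Quotient.mk (MulAction.orbitRel (siegelDeltaRat L e dV hdV dW hdW) (ratH L e dV hdV dW hdW)) 1} ∪
            Set.range (fun ν : unipDeltaRat L e dV hdV dW hdW =>
              (Quotient.mk (MulAction.orbitRel (siegelDeltaRat L e dV hdV dW hdW) (ratH L e dV hdV dW hdW)) (wq ν) :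
                SiegelDeltaQuot L e dV hdV dW hdW)))ᶜ : Set (SiegelDeltaQuot L e dV hdV dW hdW)),
          f ((((Quotient.out (q : SiegelDeltaQuot L e dV hdV dW hdW) : ratH L e dV hdV dW hdW) : HA L e dV hdV dW hdW)) *
            ((u : HA L e dV hdV dW hdW) * h)))) ∂νN) := by
  rw [fourierCoeffDelta_def]
  exact congrArg (fun z : ℂ => ((∫⁻ u, β u ∂νN).toReal⁻¹ : ℝ) • z) (fourierCoeff_cells_of_ne_one wq hwq hn νN hβ hf hfc h hH S hu₀)

end Main

end Summit.HodgeConjecture.HodgeConjecture.Cruxes.HLiu418.K2LiuSiegelEisensteinCoeffCells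

end
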